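import Mathlib
import HarnessLib
import Literature.Combinatorics.Additive.Pollard
import Literature.Combinatorics.Additive.Vosper
import Literature.Combinatorics.Additive.GrynkiewiczPollardRep

/-!
# Equality in Pollard's theorem (Nazarewicz–O'Brien–O'Neill–Staples 2007), I: duality, the dual pair,
# the `e`-transform, the criterion at `|A ∩ B| = t`, sufficiency and the endpoint cases

Topic: `Literature/Combinatorics/Additive`.  E. Nazarewicz, M. O'Brien, M. O'Neill, C. Staples,
*Equality in Pollard's theorem on set addition of congruence classes*, Acta Arith. 127 (2007) 1–15
(held `paper:doi-10-4064-aa127-1-1`, pp. 1–15 read 2026-08-28).  For a prime `p`, `A, B ⊆ ℤ/pℤ` and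
`1 ≤ t ≤ min(|A|, |B|)` write `r(x) = r_{A,B}(x) = #{(a,b) ∈ A × B : a + b = x}` (`Pollard.rep`) and
`S_t(A,B) = N_1 + ⋯ + N_t = Σ_x min(t, r(x))` (`N_i = #{x : r(x) ≥ i}`; the identity is the tree's
`Pollard.sum_min_rep_eq_sum_card_le`).  Pollard's theorem (tree: `pollard`) is
`S_t(A,B) ≥ t · min(p, |A| + |B| − t)`; the paper calls `(A, B)` *`t`-critical* when equality holds and
proves (THEOREM 3, p. 2): for `2 ≤ t ≤ min(|A|,|B|)`, `(A,B)` is `t`-critical iff (i) `min(|A|,|B|) = t`, or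
(ii) `|A| + |B| ≥ p + t`, or (iii) `|A| = |B| = t + 1` and `B = g − A`, or (iv) `A` and `B` are arithmetic
progressions with the same common difference.

This file is the first of the port (statements are theorems only; no new definitions, no named facts).
Criticality is written out as the hypothesis `Σ_x min(t, r_{A,B}(x)) = t(|A| + |B| − t)` (under
`|A| + |B| < p + t`, where `min(p, |A|+|B|−t) = |A|+|B|−t`).  Contents:

* §1 COMPLEMENT DUALITY (our organising device; implicit in the printed proofs of Lemmas 4, 5, 8, which
  pass to complements and invoke Vosper): `r_{Aᶜ,B} = |B| − r_{A,B}` and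
  `S_{|B|−t}(Aᶜ, B) + tp + |A||B| = |B|p + S_t(A,B)` (`sum_min_rep_compl_left`); hence `(A,B)` is
  `t`-critical iff `(Aᶜ, B)` is `(|B| − t)`-critical (`critical_compl_left`), and `(Aᶜ, Bᶜ)` is
  `(p − |A| − |B| + t)`-critical (`critical_compl_compl`).
* §2 THE LEVEL-`t` DUAL PAIR (the case `t = 1` is Nathanson's Lemma 2.6, tree `vosper_dual`): for a
  `t`-critical pair, `N_t ≤ |A| + |B| + 1 − 2t` (`card_popular_le`) and, with
  `D = {x : r_{A,B}(x) ≤ t − 1}`, the pair `(D, −A)` is `t`-critical (`dual_pair_critical`).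
* §3 THE `e`-TRANSFORM (printed Lemma 7, p. 6: `N_t(A(e), B(e)) ≤ N_t`): `r_{A(e),B(e)} ≤ r_{A,B}`
  pointwise for `A(e) = A ∪ (B + e)`, `B(e) = B ∩ (A − e)`; if `|B(e)| ≥ t` the transform of a
  `t`-critical pair is `t`-critical and `min(t, r_{A,B}) = min(t, r_{A(e),B(e)})` pointwise.
* §4 THE CRITERION AT `|A ∩ B| = t` (printed (5), p. 10): with `U = A ∪ B`, `I = A ∩ B`, `|I| = t`,
  `S_t(A,B) = t(|A|+|B|−t) + Σ_x min(t − r_{U,I}(x), r_{A∖B,B∖A}(x))`; so `(A,B)` is `t`-critical iff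
  `(A ∖ B) + (B ∖ A) ⊆ ⋂_{i ∈ I} (i + U)`, and then `min(t, r_{A,B}) = r_{U,I}` pointwise.
* §5 LEMMA 8 (p. 7): `2 ≤ s ≤ |B| ≤ p − 2`, `|X| = s`, `|⋂_{x ∈ X} (x + B)| ≥ |B| − s + 1` ⇒
  (`s = |B|` ⇒ `X = g − B`) and (`s < |B|` ⇒ `B` is an arithmetic progression) — by Vosper for `(X, Bᶜ)`.
* §6 SUFFICIENCY of (i)–(iv) (p. 3, Lemma 2 p. 4, and "an easy exercise"; (iv) is proved through §4).
* §7 ENDPOINT CASES: `min(|A|,|B|) = t + 1` (printed Lemmas 3, 4 and Corollary 1, p. 5) and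
  `|A| + |B| = p + t − 1` (printed Lemma 5, pp. 5–6), both obtained here from §1 and Vosper's theorem
  (tree `vosper`, `vosper_inverse`, `IsAP.compl`) — DEVIATION from print only in the bookkeeping: the
  printed proofs run the same complement/Vosper argument by hand.

Printed LEMMA 1 (an arithmetic progression forces the partner to be one), the rigid case of the proof
of Theorem 3 (pp. 10–14) and Theorem 3 itself follow in sibling files
(`PollardEqualityModPProgression.lean`, `PollardEqualityModPMain.lean`).

## References
* E. Nazarewicz, M. O'Brien, M. O'Neill, C. Staples, *Equality in Pollard's theorem on set addition of
  congruence classes*, Acta Arith. 127 (2007) 1–15 [cite: NazarewiczEtAl2007, Thm 3, Lemmas 2–8].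
* J. M. Pollard, J. London Math. Soc. (2) 8 (1974) 460–462 [cite: Pollard1974, Thm 1].
* M. B. Nathanson, *Additive Number Theory: Inverse Problems and the Geometry of Sumsets*, GTM 165
  (1996), Thm 2.4, Lemma 2.6, Thm 2.7 [cite: Nathanson1996, Lemma 2.6].
-/

namespace Literature.Combinatorics.Additive

namespace PollardEquality

open Finset Pollard Grynkiewicz
open scoped Pointwise

section General

variable {G : Type*} [AddCommGroup G] [DecidableEq G]

/-- `r_{Aᶜ,B}(x) + r_{A,B}(x) = |B|` (every `b ∈ B` has `x − b` in exactly one of `A`, `Aᶜ`).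
[cite: NazarewiczEtAl2007, Lemma 5 (proof)] -/
theorem rep_compl_left_add [Fintype G] (A B : Finset G) (x : G) :
    rep Aᶜ B x + rep A B x = #B := by
  rw [rep_eq_card_filter_right, rep_eq_card_filter_right]
  have h := card_filter_add_card_filter_not (s := B) (fun b => x - b ∈ A)
  rw [add_comm] at h
  convert h using 3
  ext b
  simp only [mem_compl]

/-- `r_{D,−A}(x) = #{a ∈ A : x + a ∈ D}`. [cite: NazarewiczEtAl2007, §2 (notation)] -/
theorem rep_neg_right (D A : Finset G) (x : G) :
    rep D (-A) x = #(A.filter fun a => x + a ∈ D) := by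
  rw [rep_eq_card_filter_right]
  refine card_nbij' (fun a => -a) (fun a => -a) ?_ ?_ ?_ ?_
  · intro a ha
    rw [mem_coe, mem_filter] at ha ⊢
    refine ⟨?_, by rw [← sub_eq_add_neg]; exact ha.2⟩
    simpa using ha.1
  · intro a ha
    rw [mem_coe, mem_filter] at ha ⊢
    refine ⟨?_, by rw [sub_neg_eq_add]; exact ha.2⟩
    simpa using ha.1
  · intro a _; simp
  · intro a _; simp

/-- `Σ_{x ∈ B} #{a ∈ A : x + a ∈ D} = Σ_{y ∈ D} r_{A,B}(y)` (count the pairs `(a,b)` with `a + b ∈ D`).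
[cite: NazarewiczEtAl2007, §2 (notation)] -/
theorem sum_card_filter_add_mem (A B D : Finset G) :
    ∑ x ∈ B, #(A.filter fun a => x + a ∈ D) = ∑ y ∈ D, rep A B y := by
  have h1 : ∑ x ∈ B, #(A.filter fun a => x + a ∈ D) =
      #((A ×ˢ B).filter fun ab => ab.1 + ab.2 ∈ D) := by
    rw [card_filter, sum_product_right]
    refine sum_congr rfl fun b _ => ?_
    rw [card_filter]
    exact sum_congr rfl fun a _ => by rw [add_comm]
  rw [h1, card_eq_sum_card_fiberwise (f := fun ab : G × G => ab.1 + ab.2)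
    (s := (A ×ˢ B).filter fun ab => ab.1 + ab.2 ∈ D) (t := D) ?_]
  swap
  · intro ab hab
    exact (mem_filter.1 (mem_coe.1 hab)).2
  refine sum_congr rfl fun y hy => ?_
  rw [rep_def, filter_filter]
  congr 1
  exact filter_congr fun ab _ => ⟨fun h => h.2, fun h => ⟨h ▸ hy, h⟩⟩

/-- `min(t, r) = min(t − 1, r) + [t ≤ r]` (so `S_t = S_{t−1} + N_t`). [cite: NazarewiczEtAl2007, §2] -/
theorem min_eq_min_pred_add (t r : ℕ) (ht : 1 ≤ t) :
    min t r = min (t - 1) r + if t ≤ r then 1 else 0 := by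
  split_ifs with h <;> omega

/-- `S_t(A,B) = S_{t−1}(A,B) + N_t(A,B)` with `N_t = #{x : r(x) ≥ t}`.
[cite: NazarewiczEtAl2007, §2 (notation `S(A,B,t) = N_1 + ⋯ + N_t`)] -/
theorem sum_min_rep_eq_pred_add_card [Fintype G] (A B : Finset G) {t : ℕ} (ht : 1 ≤ t) :
    ∑ x, min t (rep A B x) =
      ∑ x, min (t - 1) (rep A B x) + #(univ.filter fun x => t ≤ rep A B x) := by
  rw [card_filter, ← sum_add_distrib]
  exact Fintype.sum_congr _ _ fun x => min_eq_min_pred_add t _ ht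

/-- `S_t(A,B) = t · N_t + Σ_{x : r(x) < t} r(x)` over the whole group.
[cite: NazarewiczEtAl2007, §2 (notation)] -/
theorem sum_min_rep_eq_mul_card_add [Fintype G] (A B : Finset G) (t : ℕ) :
    ∑ x, min t (rep A B x) =
      t * #(univ.filter fun x => t ≤ rep A B x) + ∑ x ∈ univ.filter (fun x => rep A B x < t), rep A B x := by
  rw [← sum_filter_add_sum_filter_not univ (fun x => t ≤ rep A B x)]
  congr 1
  · rw [sum_const_nat (m := t) fun x hx => min_eq_left (mem_filter.1 hx).2, mul_comm]
  · have : univ.filter (fun x => ¬ t ≤ rep A B x) = univ.filter (fun x => rep A B x < t) :=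
      filter_congr fun x _ => not_le
    rw [this]
    exact sum_congr rfl fun x hx => min_eq_right (mem_filter.1 hx).2.le

end General

section ZModP

variable {p : ℕ} [hp : Fact p.Prime]

/-! ### §1 Complement duality -/

/-- **Complement duality.**  For `t ≤ |B|`:
`S_{|B|−t}(Aᶜ, B) + t·p + |A||B| = |B|·p + S_t(A, B)` — from `r_{Aᶜ,B} = |B| − r_{A,B}` and
`min(|B|−t, |B|−r) + t + r = |B| + min(t, r)`.  (The printed proofs of Lemmas 4, 5 and 8 pass to
complements ad hoc; this identity packages the move.) [cite: NazarewiczEtAl2007, Lemma 5 (proof)] -/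
theorem sum_min_rep_compl_left (A B : Finset (ZMod p)) {t : ℕ} (ht : t ≤ #B) :
    ∑ x, min (#B - t) (rep Aᶜ B x) + t * p + #A * #B = #B * p + ∑ x, min t (rep A B x) := by
  have hpt : ∀ x : ZMod p, min (#B - t) (rep Aᶜ B x) + t + rep A B x = #B + min t (rep A B x) := by
    intro x
    have h1 := rep_compl_left_add A B x
    have h2 := rep_le_card_right A B x
    omega
  have hsum := Fintype.sum_congr _ _ hpt
  rw [sum_add_distrib, sum_add_distrib, sum_add_distrib, sum_rep] at hsum
  simp only [sum_const, card_univ, ZMod.card, smul_eq_mul] at hsum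
  linarith [hsum]

/-- **Criticality passes to the complement of one set**: if `t ≤ |A|`, `t ≤ |B|` and
`S_t(A,B) = t(|A|+|B|−t)`, then `S_{|B|−t}(Aᶜ, B) = (|B|−t)(|Aᶜ| + |B| − (|B|−t))`
(and `|Aᶜ| + |B| − (|B| − t) = p − |A| + t ≤ p`). [cite: NazarewiczEtAl2007, Lemma 5 (proof)] -/
theorem critical_compl_left {A B : Finset (ZMod p)} {t : ℕ} (htA : t ≤ #A) (htB : t ≤ #B)
    (hcrit : ∑ x, min t (rep A B x) = t * (#A + #B - t)) :
    ∑ x, min (#B - t) (rep Aᶜ B x) = (#B - t) * (#Aᶜ + #B - (#B - t)) := by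
  have hid := sum_min_rep_compl_left A B htB
  rw [hcrit] at hid
  have hAp : #A ≤ p := (card_le_univ A).trans (ZMod.card p).le
  rw [card_compl, ZMod.card]
  obtain ⟨K, hK⟩ : ∃ K, #A = t + K := ⟨#A - t, by omega⟩
  obtain ⟨L, hL⟩ : ∃ L, #B = t + L := ⟨#B - t, by omega⟩
  obtain ⟨q, hq⟩ : ∃ q, p = #A + q := ⟨p - #A, by omega⟩
  have e1 : #A + #B - t = K + L + t := by omega
  have e2 : #B - t = L := by omega
  have e3 : p - #A + #B - (#B - t) = q + t := by omega
  rw [e1, e2] at hid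
  rw [e3, e2]
  rw [hK, hL] at hid
  rw [hK] at hq
  obtain ⟨X, hX⟩ : ∃ X, ∑ x, min L (rep Aᶜ B x) = X := ⟨_, rfl⟩
  rw [hX] at hid ⊢
  zify at hid hq ⊢
  linear_combination hid + (L : ℤ) * hq

/-- The symmetric form: criticality passes to the complement of the second set.
[cite: NazarewiczEtAl2007, Lemma 5 (proof)] -/
theorem critical_compl_right {A B : Finset (ZMod p)} {t : ℕ} (htA : t ≤ #A) (htB : t ≤ #B)
    (hcrit : ∑ x, min t (rep A B x) = t * (#A + #B - t)) :
    ∑ x, min (#A - t) (rep A Bᶜ x) = (#A - t) * (#A + #Bᶜ - (#A - t)) := by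
  have hcrit' : ∑ x, min t (rep B A x) = t * (#B + #A - t) := by
    rw [add_comm #B, ← hcrit]
    exact Fintype.sum_congr _ _ fun x => by rw [rep_comm]
  have h := critical_compl_left htB htA hcrit'
  rw [add_comm #Bᶜ #A] at h
  rw [← h]
  exact Fintype.sum_congr _ _ fun x => by rw [rep_comm]

/-- **Criticality passes to the complements of both sets**: under `t ≤ |A|, |B|` and
`|A| + |B| ≤ p + t − 1`, a `t`-critical pair `(A,B)` gives a `(p − |A| − |B| + t)`-critical pair
`(Aᶜ, Bᶜ)`: `S_{p+t−|A|−|B|}(Aᶜ,Bᶜ) = (p+t−|A|−|B|)·(p − t)`.  (For `|A| + |B| = p + t − 1` this is a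
Cauchy–Davenport-critical pair — the printed proof of Lemma 5.) [cite: NazarewiczEtAl2007, Lemma 5 (proof)] -/
theorem critical_compl_compl {A B : Finset (ZMod p)} {t : ℕ} (htA : t ≤ #A) (htB : t ≤ #B)
    (hAB : #A + #B ≤ p + t) (hcrit : ∑ x, min t (rep A B x) = t * (#A + #B - t)) :
    ∑ x, min (p + t - #A - #B) (rep Aᶜ Bᶜ x) = (p + t - #A - #B) * (p - t) := by
  have hAp : #A ≤ p := (card_le_univ A).trans (ZMod.card p).le
  have hBp : #B ≤ p := (card_le_univ B).trans (ZMod.card p).le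
  have h1 := critical_compl_left htA htB hcrit
  have hcA : #Aᶜ = p - #A := by rw [card_compl, ZMod.card]
  have hcB : #Bᶜ = p - #B := by rw [card_compl, ZMod.card]
  -- apply `critical_compl_right` to the pair `(Aᶜ, B)` at level `|B| - t`
  have h2 := critical_compl_right (A := Aᶜ) (B := B) (t := #B - t) (by rw [hcA]; omega) (by omega) h1
  rw [hcA, hcB] at h2
  have e2 : p - #A - (#B - t) = p + t - #A - #B := by omega
  have e3 : p - #A + (p - #B) - (p + t - #A - #B) = p - t := by omega
  rw [e2, e3] at h2
  exact h2

/-! ### §2 The popular sums of a critical pair and the level-`t` dual pair -/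

/-- For a `t`-critical pair with `1 ≤ t ≤ min(|A|,|B|)` and `|A| + |B| ≤ p + t − 1`:
`N_t = #{x : r(x) ≥ t} ≤ |A| + |B| + 1 − 2t` (Pollard's theorem at level `t − 1`).
[cite: NazarewiczEtAl2007, Thm 3 (proof, Step 1)] -/
theorem card_popular_le {A B : Finset (ZMod p)} {t : ℕ} (ht : 1 ≤ t) (htA : t ≤ #A) (htB : t ≤ #B)
    (hAB : #A + #B ≤ p + t - 1) (hcrit : ∑ x, min t (rep A B x) = t * (#A + #B - t)) :
    #(univ.filter fun x => t ≤ rep A B x) + 2 * t ≤ #A + #B + 1 := by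
  have hsplit := sum_min_rep_eq_pred_add_card A B ht
  rcases Nat.lt_or_ge t 2 with ht1 | ht2
  · -- `t = 1`: `S_1 = N_1`
    have ht1' : t = 1 := by omega
    subst ht1'
    have h0 : ∑ x, min (1 - 1) (rep A B x) = 0 := by simp
    rw [h0, zero_add] at hsplit
    rw [← hsplit, hcrit]
    omega
  · have hpol := pollard A B (t := t - 1) (by omega) (by omega) (by omega)
    have hmin : min p (#A + #B - (t - 1)) = #A + #B - (t - 1) := min_eq_right (by omega)
    rw [hmin] at hpol
    rw [hcrit] at hsplit
    -- `t(|A|+|B|-t) = S_{t-1} + N_t ≥ (t-1)(|A|+|B|-t+1) + N_t`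
    have key : (t - 1) * (#A + #B - (t - 1)) + #(univ.filter fun x => t ≤ rep A B x) ≤
        t * (#A + #B - t) := by rw [hsplit]; exact Nat.add_le_add_right hpol _
    obtain ⟨s, hs⟩ : ∃ s, #A + #B = 2 * t + s ∨ #A + #B + 1 = 2 * t + 0 ∧ s = 0 := by
      rcases Nat.lt_or_ge (#A + #B) (2 * t) with h | h
      · exact ⟨0, Or.inr ⟨by omega, rfl⟩⟩
      · exact ⟨#A + #B - 2 * t, Or.inl (by omega)⟩
    rcases hs with hs | ⟨hs, -⟩
    · obtain ⟨u, hu⟩ : ∃ u, t = u + 1 := ⟨t - 1, by omega⟩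
      subst hu
      rw [hs] at key ⊢
      have e1 : 2 * (u + 1) + s - (u + 1 - 1) = u + s + 2 := by omega
      have e2 : 2 * (u + 1) + s - (u + 1) = u + s + 1 := by omega
      rw [e1, e2, Nat.add_sub_cancel] at key
      nlinarith [key]
    · omega

/-- **The level-`t` dual pair** (for `t = 1`: Nathanson's Lemma 2.6 / the tree's `vosper_dual`).  Let
`(A,B)` be `t`-critical with `1 ≤ t ≤ min(|A|,|B|)`, `|A| + |B| ≤ p + t − 1`, and let
`D = {x : r_{A,B}(x) ≤ t − 1}` (the complement of the `t`-popular sums).  Then `|D| ≥ t` and `(D, −A)` is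
`t`-critical: `S_t(D, −A) = t · min(p, |D| + |A| − t)`.  (Upper bound: sums `x ∉ B` contribute `≤ t`
each, and `Σ_{x ∈ B} #{a : x + a ∈ D} = Σ_{r(y) < t} r(y) = S_t − t N_t`; lower bound: Pollard.)
[cite: NazarewiczEtAl2007, Thm 3 (proof)] [cite: Nathanson1996, Lemma 2.6] -/
theorem dual_pair_critical {A B : Finset (ZMod p)} {t : ℕ} (ht : 1 ≤ t) (htA : t ≤ #A) (htB : t ≤ #B)
    (hAB : #A + #B ≤ p + t - 1) (hcrit : ∑ x, min t (rep A B x) = t * (#A + #B - t)) :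
    t ≤ #(univ.filter fun x => rep A B x < t) ∧
      ∑ x, min t (rep (univ.filter fun x => rep A B x < t) (-A) x) =
        t * min p (#(univ.filter fun x => rep A B x < t) + #A - t) := by
  obtain ⟨D, hD⟩ : ∃ D : Finset (ZMod p), D = univ.filter fun x => rep A B x < t := ⟨_, rfl⟩
  obtain ⟨C, hC⟩ : ∃ C : Finset (ZMod p), C = univ.filter fun x => t ≤ rep A B x := ⟨_, rfl⟩
  rw [← hD]
  have hAp : #A ≤ p := (card_le_univ A).trans (ZMod.card p).le
  have hBp : #B ≤ p := (card_le_univ B).trans (ZMod.card p).le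
  have hCD : #C + #D = p := by
    have h := card_filter_add_card_filter_not (s := (univ : Finset (ZMod p)))
      (fun x => t ≤ rep A B x)
    rw [card_univ, ZMod.card] at h
    have hD' : D = univ.filter fun x => ¬ t ≤ rep A B x := by
      rw [hD]; exact filter_congr fun x _ => lt_iff_not_ge
    rw [hC, hD']
    exact h
  have hCle := card_popular_le ht htA htB hAB hcrit
  rw [← hC] at hCle
  have hDt : t ≤ #D := by omega
  refine ⟨hDt, ?_⟩
  -- the split `S_t = t N_t + Σ_{r < t} r`
  have hsplit := sum_min_rep_eq_mul_card_add A B t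
  rw [← hC, ← hD, hcrit] at hsplit
  obtain ⟨M, hM⟩ : ∃ M, #A + #B - t = M + #C := ⟨#A + #B - t - #C, by omega⟩
  rw [hM, mul_add, add_comm (t * M)] at hsplit
  have hsumD : ∑ x ∈ D, rep A B x = t * M := (Nat.add_left_cancel hsplit).symm
  -- upper bound
  have hup : ∑ x, min t (rep D (-A) x) ≤ t * (#D + #A - t) := by
    rw [← sum_filter_add_sum_filter_not univ (fun x => x ∈ B)]
    have hB' : univ.filter (fun x : ZMod p => x ∈ B) = B := by ext x; simp
    have hBc : univ.filter (fun x : ZMod p => ¬ x ∈ B) = Bᶜ := by ext x; simp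
    rw [hB', hBc]
    have h1 : ∑ x ∈ B, min t (rep D (-A) x) ≤ ∑ y ∈ D, rep A B y := by
      rw [← sum_card_filter_add_mem A B D]
      exact sum_le_sum fun x _ => by rw [rep_neg_right]; exact min_le_right _ _
    have h2 : ∑ x ∈ Bᶜ, min t (rep D (-A) x) ≤ t * (p - #B) := by
      calc ∑ x ∈ Bᶜ, min t (rep D (-A) x) ≤ ∑ _x ∈ Bᶜ, t := sum_le_sum fun x _ => min_le_left _ _
        _ = t * (p - #B) := by rw [sum_const, smul_eq_mul, card_compl, ZMod.card, mul_comm]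
    have h4 : #D + #A - t = M + (p - #B) := by omega
    rw [h4, mul_add]
    calc ∑ x ∈ B, min t (rep D (-A) x) + ∑ x ∈ Bᶜ, min t (rep D (-A) x)
        ≤ ∑ y ∈ D, rep A B y + t * (p - #B) := add_le_add h1 h2
      _ = t * M + t * (p - #B) := by rw [hsumD]
  -- lower bound: Pollard for `(D, -A)`
  have hpol := pollard D (-A) ht hDt (by rw [card_neg]; exact htA)
  rw [card_neg] at hpol
  -- trivial bound `≤ tp`
  have htp : ∑ x, min t (rep D (-A) x) ≤ t * p := by
    calc ∑ x, min t (rep D (-A) x) ≤ ∑ _x : ZMod p, t := sum_le_sum fun x _ => min_le_left _ _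
      _ = t * p := by rw [sum_const, card_univ, ZMod.card, smul_eq_mul, mul_comm]
  rcases le_total p (#D + #A - t) with h | h
  · rw [min_eq_left h] at hpol ⊢
    exact le_antisymm htp hpol
  · rw [min_eq_right h] at hpol ⊢
    exact le_antisymm hup hpol

end ZModP

/-! ### §3 The `e`-transform (printed Lemma 7) -/

section ETransform

variable {G : Type*} [AddCommGroup G] [DecidableEq G]

/-- `A ∩ (e + B) = e + (B ∩ (A − e))`. [cite: NazarewiczEtAl2007, §1 (properties of the `e`-transform)] -/
theorem inter_vadd_eq (A B : Finset G) (e : G) : A ∩ (e +ᵥ B) = e +ᵥ (B ∩ (-e +ᵥ A)) := by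
  rw [vadd_finset_inter, vadd_neg_vadd, inter_comm]

/-- **Lemma 7** (pointwise form): `r_{A(e),B(e)}(x) ≤ r_{A,B}(x)` for the `e`-transform
`A(e) = A ∪ (B + e)`, `B(e) = B ∩ (A − e)`; indeed
`r_{A,B} = r_{A(e),B(e)} + r_{A ∖ (B+e), B ∖ (A−e)}` ("see [Nathanson, pp. 46–47]").
[cite: NazarewiczEtAl2007, Lemma 7] -/
theorem rep_etransform_add (A B : Finset G) (e x : G) :
    rep (A ∪ (e +ᵥ B)) (B ∩ (-e +ᵥ A)) x + rep (A \ (e +ᵥ B)) (B \ (-e +ᵥ A)) x = rep A B x := by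
  have h := rep_eq_rep_union_inter_add A (e +ᵥ B) (x + e)
  rw [rep_vadd_right, add_sub_cancel_right] at h
  rw [h, inter_vadd_eq A B e, rep_vadd_right (A ∪ (e +ᵥ B)) (B ∩ (-e +ᵥ A)) e (x + e),
    add_sub_cancel_right]
  congr 1
  have hs : (e +ᵥ B) \ A = e +ᵥ (B \ (-e +ᵥ A)) := by
    rw [vadd_finset_sdiff, vadd_neg_vadd]
  rw [hs, rep_vadd_right (A \ (e +ᵥ B)) (B \ (-e +ᵥ A)) e (x + e), add_sub_cancel_right]

/-- **Lemma 7**: `r_{A(e),B(e)} ≤ r_{A,B}` pointwise (hence `N_t(A(e),B(e)) ≤ N_t(A,B)` for every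
`t`). [cite: NazarewiczEtAl2007, Lemma 7] -/
theorem rep_etransform_le (A B : Finset G) (e x : G) :
    rep (A ∪ (e +ᵥ B)) (B ∩ (-e +ᵥ A)) x ≤ rep A B x := by
  rw [← rep_etransform_add A B e x]; exact Nat.le_add_right _ _

/-- `|A(e)| + |B(e)| = |A| + |B|` (property (3) of the `e`-transform).
[cite: NazarewiczEtAl2007, §1 (property (3))] -/
theorem card_etransform (A B : Finset G) (e : G) :
    #(A ∪ (e +ᵥ B)) + #(B ∩ (-e +ᵥ A)) = #A + #B := by
  have h := Finset.addDysonETransform.card e (A, B)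
  simpa using h

end ETransform

section ETransformZMod

variable {p : ℕ} [hp : Fact p.Prime]

/-- Pointwise `≤` and equal sums force pointwise equality. [folklore] -/
private theorem eq_of_sum_eq_of_le {ι : Type*} (s : Finset ι) {f g : ι → ℕ} (hle : ∀ i ∈ s, f i ≤ g i)
    (hsum : ∑ i ∈ s, g i ≤ ∑ i ∈ s, f i) : ∀ i ∈ s, f i = g i := by
  by_contra hne
  push Not at hne
  obtain ⟨i, hi, hne⟩ := hne
  have hlt : f i < g i := lt_of_le_of_ne (hle i hi) hne
  have := sum_lt_sum hle ⟨i, hi, hlt⟩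
  omega

/-- **The `e`-transform of a `t`-critical pair** (the use of Lemma 7 in the proof of Theorem 3, p. 8):
if `(A,B)` is `t`-critical with `|A| + |B| ≤ p + t` and `|B(e)| ≥ t`, then `(A(e), B(e))` is
`t`-critical and `min(t, r_{A(e),B(e)}) = min(t, r_{A,B})` pointwise ("by Lemma 7 it follows that
`N'_i = N_i` for `1 ≤ i ≤ t`"). [cite: NazarewiczEtAl2007, Thm 3 (proof, Step 1)] -/
theorem etransform_critical {A B : Finset (ZMod p)} {t : ℕ} (e : ZMod p) (ht : 1 ≤ t) (htA : t ≤ #A)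
    (htI : t ≤ #(B ∩ (-e +ᵥ A))) (hAB : #A + #B ≤ p + t)
    (hcrit : ∑ x, min t (rep A B x) = t * (#A + #B - t)) :
    ∑ x, min t (rep (A ∪ (e +ᵥ B)) (B ∩ (-e +ᵥ A)) x) =
        t * (#(A ∪ (e +ᵥ B)) + #(B ∩ (-e +ᵥ A)) - t) ∧
      ∀ x, min t (rep (A ∪ (e +ᵥ B)) (B ∩ (-e +ᵥ A)) x) = min t (rep A B x) := by
  have hcard := card_etransform A B e
  have hle : ∀ x ∈ (univ : Finset (ZMod p)),
      min t (rep (A ∪ (e +ᵥ B)) (B ∩ (-e +ᵥ A)) x) ≤ min t (rep A B x) :=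
    fun x _ => min_le_min_left _ (rep_etransform_le A B e x)
  have hpol := pollard (A ∪ (e +ᵥ B)) (B ∩ (-e +ᵥ A)) ht (htA.trans (card_le_card subset_union_left)) htI
  rw [hcard, min_eq_right (by omega)] at hpol
  have hsum : ∑ x, min t (rep A B x) ≤ ∑ x, min t (rep (A ∪ (e +ᵥ B)) (B ∩ (-e +ᵥ A)) x) := by
    rw [hcrit]; exact hpol
  have heq := eq_of_sum_eq_of_le univ hle hsum
  refine ⟨?_, fun x => heq x (mem_univ x)⟩
  rw [hcard, ← hcrit]
  exact Fintype.sum_congr _ _ fun x => heq x (mem_univ x)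

end ETransformZMod

/-! ### §4 The criterion at `|A ∩ B| = t` (printed (5)) -/

section Criterion

variable {G : Type*} [AddCommGroup G] [DecidableEq G]

/-- `r_{U,I}(x) = |I|` iff `x − I ⊆ U`. [cite: NazarewiczEtAl2007, Thm 3 (proof, (5))] -/
theorem rep_eq_card_right_iff (U I : Finset G) (x : G) :
    rep U I x = #I ↔ ∀ i ∈ I, x - i ∈ U := by
  rw [rep_eq_card_filter_right]
  constructor
  · intro h i hi
    have hEq : I.filter (fun i => x - i ∈ U) = I := eq_of_subset_of_card_le (filter_subset _ _) h.ge
    have hi' : i ∈ I.filter (fun i => x - i ∈ U) := by rw [hEq]; exact hi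
    exact (mem_filter.1 hi').2
  · intro h
    rw [filter_true_of_mem h]

/-- **The identity behind (5)**: if `|A ∩ B| = t` then, with `U = A ∪ B`, `I = A ∩ B`,
`A' = A ∖ B`, `B' = B ∖ A`,
`S_t(A,B) = t·|U| + Σ_x min(t − r_{U,I}(x), r_{A',B'}(x))`
(from `r_{A,B} = r_{U,I} + r_{A',B'}` and `r_{U,I} ≤ |I| = t`; for any finite ambient group).
[cite: NazarewiczEtAl2007, Thm 3 (proof, pp. 8–10)] -/
theorem sum_min_rep_eq_of_card_inter [Fintype G] {A B : Finset G} {t : ℕ} (hI : #(A ∩ B) = t) :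
    ∑ x, min t (rep A B x) =
      t * #(A ∪ B) + ∑ x, min (t - rep (A ∪ B) (A ∩ B) x) (rep (A \ B) (B \ A) x) := by
  have hpt : ∀ x, min t (rep A B x) =
      rep (A ∪ B) (A ∩ B) x + min (t - rep (A ∪ B) (A ∩ B) x) (rep (A \ B) (B \ A) x) := by
    intro x
    rw [rep_eq_rep_union_inter_add A B x]
    have hu : rep (A ∪ B) (A ∩ B) x ≤ t := hI ▸ rep_le_card_right _ _ x
    omega
  rw [Fintype.sum_congr _ _ hpt, sum_add_distrib, sum_rep, hI, mul_comm]

/-- **The criterion (5)**: if `|A ∩ B| = t`, then `(A,B)` is `t`-critical (`S_t(A,B) = t(|A|+|B|−t)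
= t|A ∪ B|`) iff every sum `a' + b'` with `a' ∈ A ∖ B`, `b' ∈ B ∖ A` lies in `⋂_{i ∈ A ∩ B} (i + (A ∪ B))`
("`A' + B' ⊆ ⋂_{b ∈ I} (b + U)`").  [cite: NazarewiczEtAl2007, Thm 3 (proof, (5))] -/
theorem critical_iff_of_card_inter [Fintype G] {A B : Finset G} {t : ℕ} (hI : #(A ∩ B) = t) :
    ∑ x, min t (rep A B x) = t * #(A ∪ B) ↔
      ∀ a ∈ A \ B, ∀ b ∈ B \ A, ∀ i ∈ A ∩ B, a + b - i ∈ A ∪ B := by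
  rw [sum_min_rep_eq_of_card_inter hI]
  constructor
  · intro h a ha b hb
    have h0 : ∑ x, min (t - rep (A ∪ B) (A ∩ B) x) (rep (A \ B) (B \ A) x) = 0 := by omega
    have hx := (sum_eq_zero_iff.1 h0) (a + b) (mem_univ _)
    have hr : 1 ≤ rep (A \ B) (B \ A) (a + b) := one_le_rep_add ha hb
    have hfull : rep (A ∪ B) (A ∩ B) (a + b) = #(A ∩ B) := by
      have := rep_le_card_right (A ∪ B) (A ∩ B) (a + b); omega
    exact (rep_eq_card_right_iff _ _ _).1 hfull
  · intro h
    suffices h0 : ∑ x, min (t - rep (A ∪ B) (A ∩ B) x) (rep (A \ B) (B \ A) x) = 0 by omega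
    refine sum_eq_zero fun x _ => ?_
    by_cases hx : rep (A \ B) (B \ A) x = 0
    · rw [hx, Nat.min_zero]
    · obtain ⟨a, ha, b, hb, rfl⟩ := mem_add.1 ((rep_pos_iff).1 (Nat.pos_of_ne_zero hx))
      have hfull : rep (A ∪ B) (A ∩ B) (a + b) = #(A ∩ B) :=
        (rep_eq_card_right_iff _ _ _).2 (h a ha b hb)
      rw [hfull, hI, Nat.sub_self, Nat.zero_min]

/-- Under criticality at `|A ∩ B| = t`: `min(t, r_{A,B}) = r_{U,I}` pointwise
("`r_{U,I}(x) = r_{A,B}(x)` whenever `r_{A,B}(x) < t`, and `{x : r_{A,B}(x) ≥ t} = {x : r_{U,I}(x) = t}`").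
[cite: NazarewiczEtAl2007, Thm 3 (proof, p. 11)] -/
theorem min_rep_eq_rep_union_inter [Fintype G] {A B : Finset G} {t : ℕ} (hI : #(A ∩ B) = t)
    (hcrit : ∑ x, min t (rep A B x) = t * #(A ∪ B)) (x : G) :
    min t (rep A B x) = rep (A ∪ B) (A ∩ B) x := by
  have hid := sum_min_rep_eq_of_card_inter (A := A) (B := B) hI
  rw [hcrit] at hid
  have h0 : ∑ x, min (t - rep (A ∪ B) (A ∩ B) x) (rep (A \ B) (B \ A) x) = 0 := by omega
  have hx := (sum_eq_zero_iff.1 h0) x (mem_univ _)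
  rw [rep_eq_rep_union_inter_add A B x]
  have hu : rep (A ∪ B) (A ∩ B) x ≤ t := hI ▸ rep_le_card_right _ _ x
  omega

/-- Under criticality at `|A ∩ B| = t`: `r_{A,B}(x) ≥ t` iff `x − (A ∩ B) ⊆ A ∪ B`.
[cite: NazarewiczEtAl2007, Thm 3 (proof, p. 11)] -/
theorem le_rep_iff_of_critical [Fintype G] {A B : Finset G} {t : ℕ} (hI : #(A ∩ B) = t)
    (hcrit : ∑ x, min t (rep A B x) = t * #(A ∪ B)) (x : G) :
    t ≤ rep A B x ↔ ∀ i ∈ A ∩ B, x - i ∈ A ∪ B := by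
  rw [← rep_eq_card_right_iff, hI, ← min_rep_eq_rep_union_inter hI hcrit x]
  constructor
  · intro h; exact min_eq_left h
  · intro h; exact (min_eq_left_iff.1 h)

end Criterion

section ZModP2

variable {p : ℕ} [hp : Fact p.Prime]

/-! ### §5 Lemma 8 -/

/-- `x ↦ c − x` is an involution, so `(Aᶜ.image (c − ·))ᶜ = A.image (c − ·)`.
[cite: NazarewiczEtAl2007, Lemma 8 (proof)] -/
theorem compl_image_sub_compl (A : Finset (ZMod p)) (c : ZMod p) :
    (Aᶜ.image (c - ·))ᶜ = A.image (c - ·) := by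
  ext x
  simp only [mem_compl, mem_image, not_exists, not_and]
  constructor
  · intro h
    refine ⟨c - x, ?_, sub_sub_cancel c x⟩
    by_contra hx
    exact h (c - x) hx (sub_sub_cancel c x)
  · rintro ⟨a, ha, rfl⟩ y hy hya
    apply hy
    have : y = a := by
      have := congrArg (c - ·) hya
      simpa using this
    rwa [this]

/-- `Σ_x min(1, r_{A,B}(x)) = |A + B|` (`S_1 = N_1`). [cite: NazarewiczEtAl2007, §2 (notation)] -/
theorem sum_min_one_rep (A B : Finset (ZMod p)) : ∑ x, min 1 (rep A B x) = #(A + B) := by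
  have h : ∀ x, min 1 (rep A B x) = if x ∈ A + B then 1 else 0 := by
    intro x
    by_cases hx : x ∈ A + B
    · rw [if_pos hx, min_eq_left (one_le_rep_of_mem hx)]
    · rw [if_neg hx, rep_eq_zero_of_not_mem hx, Nat.min_zero]
  rw [Fintype.sum_congr _ _ h, sum_boole, Nat.cast_id]
  congr 1
  ext x; simp

/-- **Lemma 8.**  Let `2 ≤ s ≤ |B| ≤ p − 2`, `|X| = s`, and suppose
`|⋂_{x ∈ X} (x + B)| ≥ |B| − (s − 1)`.  If `s = |B|` then `X = g − B` for some `g`; if `s < |B|` then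
`B` is an arithmetic progression.  (Proof as printed: `|X + Bᶜ| ≤ |X| + |Bᶜ| − 1`, so `(X, Bᶜ)` is a
critical pair; then Vosper's theorem.)  The intersection is written as
`{y : ∀ x ∈ X, y − x ∈ B}`. [cite: NazarewiczEtAl2007, Lemma 8] -/
theorem lemma8 {B X : Finset (ZMod p)} {s : ℕ} (hs2 : 2 ≤ s) (hsB : s ≤ #B) (hBp : #B + 2 ≤ p)
    (hX : #X = s) (hbig : #B + 1 ≤ #(univ.filter fun y => ∀ x ∈ X, y - x ∈ B) + s) :
    (s = #B → ∃ g, X = B.image (g - ·)) ∧ (s < #B → ∃ d, d ≠ 0 ∧ IsAP B d) := by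
  have hp2 := hp.out.two_le
  obtain ⟨Y, hY⟩ : ∃ Y : Finset (ZMod p), Y = univ.filter fun y => ∀ x ∈ X, y - x ∈ B := ⟨_, rfl⟩
  rw [← hY] at hbig
  -- `Yᶜ = X + Bᶜ`
  have hYc : Yᶜ = X + Bᶜ := by
    ext y
    rw [hY, mem_compl, mem_filter, mem_add]
    simp only [mem_univ, true_and, not_forall]
    constructor
    · rintro ⟨x, hx, hxy⟩
      exact ⟨x, hx, y - x, mem_compl.2 hxy, by abel⟩
    · rintro ⟨x, hx, z, hz, rfl⟩
      exact ⟨x, hx, by rw [mem_compl] at hz; simpa using hz⟩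
  have hXne : X.Nonempty := card_pos.1 (by omega)
  have hBc : #Bᶜ = p - #B := by rw [card_compl, ZMod.card]
  have hBcne : Bᶜ.Nonempty := card_pos.1 (by omega)
  have hcardXB : #(X + Bᶜ) = p - #Y := by rw [← hYc, card_compl, ZMod.card]
  have hYp : #Y ≤ p := (card_le_univ Y).trans (ZMod.card p).le
  have hne : X + Bᶜ ≠ univ := by
    intro h
    have := congrArg card h
    rw [hcardXB, card_univ, ZMod.card] at this
    omega
  have hcd := Vosper.cauchy_davenport_of_ne_univ hXne hBcne hne
  have hcrit : #(X + Bᶜ) = #X + #Bᶜ - 1 := by omega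
  have hv := (vosper hXne hBcne hne).1 hcrit
  -- unique missing point when `|X + Bᶜ| = p - 1`
  have hsporadic : #(X + Bᶜ) = p - 1 → ∃ g, X = B.image (g - ·) := by
    intro hp1
    have hcne : (X + Bᶜ)ᶜ.Nonempty := by
      rw [← card_pos, card_compl, ZMod.card]; omega
    obtain ⟨c, hc⟩ := hcne
    rw [mem_compl] at hc
    refine ⟨c, ?_⟩
    -- `Bᶜ ⊆ (c - X)ᶜ`, equal cards
    have hsub : Bᶜ ⊆ (X.image (c - ·))ᶜ := by
      intro z hz
      rw [mem_compl, mem_image]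
      rintro ⟨x, hx, rfl⟩
      exact hc (by simpa using add_mem_add hx hz)
    have hcimg : #(X.image (c - ·)) = #X := card_image_of_injective _ sub_right_injective
    have heq : Bᶜ = (X.image (c - ·))ᶜ := by
      refine eq_of_subset_of_card_le hsub ?_
      rw [card_compl, card_compl, hcimg]
      have : #X + #Bᶜ = p := by omega
      rw [ZMod.card]; omega
    have hB : B = X.image (c - ·) := by
      have := congrArg compl heq
      rwa [compl_compl, compl_compl] at this
    rw [hB, image_image]
    have : ((c - ·) ∘ (c - ·) : ZMod p → ZMod p) = id := by ext z; simp
    rw [this, image_id]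
  refine ⟨fun hsb => ?_, fun hsb => ?_⟩
  · apply hsporadic
    omega
  · rcases hv with hmin | ⟨hp1, -⟩ | ⟨d, hXd, hBd⟩
    · exfalso
      rcases Nat.le_total #X #Bᶜ with h | h
      · rw [min_eq_left h] at hmin; omega
      · rw [min_eq_right h] at hmin; omega
    · exfalso; omega
    · have hd : d ≠ 0 := hXd.ne_zero (by omega)
      refine ⟨d, hd, ?_⟩
      have := hBd.compl hd
      rwa [compl_compl] at this

/-- **Lemma 8, intersection bound** (the contrapositive form used on pp. 11–12): if `B` is not an
arithmetic progression, `2 ≤ |X| < |B| ≤ p − 2`, then `|⋂_{x ∈ X} (x + B)| ≤ |B| − |X|`.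
[cite: NazarewiczEtAl2007, Lemma 8] -/
theorem card_iInter_vadd_le {B X : Finset (ZMod p)} (hX2 : 2 ≤ #X) (hXB : #X < #B) (hBp : #B + 2 ≤ p)
    (hB : ∀ d, d ≠ 0 → ¬ IsAP B d) :
    #(univ.filter fun y => ∀ x ∈ X, y - x ∈ B) + #X ≤ #B := by
  by_contra h
  push Not at h
  obtain ⟨d, hd, hAP⟩ := (lemma8 hX2 hXB.le hBp rfl (by omega)).2 hXB
  exact hB d hd hAP

/-- If `|X| > |B|` then `⋂_{x ∈ X} (x + B) = ∅` (for `y` in the intersection, `y − X ⊆ B`).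
[cite: NazarewiczEtAl2007, Thm 3 (proof, p. 11)] -/
theorem filter_forall_sub_mem_eq_empty {G : Type*} [AddCommGroup G] [DecidableEq G] [Fintype G]
    {B X : Finset G} (h : #B < #X) :
    (univ.filter fun y => ∀ x ∈ X, y - x ∈ B) = ∅ := by
  rw [← not_nonempty_iff_eq_empty]
  rintro ⟨y, hy⟩
  rw [mem_filter] at hy
  have : #X ≤ #B := by
    rw [← card_image_of_injective X (sub_right_injective : Function.Injective fun x : G => y - x)]
    exact card_le_card fun z hz => by
      obtain ⟨x, hx, rfl⟩ := mem_image.1 hz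
      exact hy.2 x hx
  omega

/-- If `|X| = |B|` and `y ∈ ⋂_{x ∈ X} (x + B)` then `X = y − B`.
[cite: NazarewiczEtAl2007, Thm 3 (proof, p. 11)] -/
theorem eq_image_sub_of_mem_filter {G : Type*} [AddCommGroup G] [DecidableEq G] [Fintype G]
    {B X : Finset G} (h : #X = #B) {y : G}
    (hy : y ∈ univ.filter fun y => ∀ x ∈ X, y - x ∈ B) : X = B.image (y - ·) := by
  rw [mem_filter] at hy
  have hsub : X.image (y - ·) ⊆ B := fun z hz => by
    obtain ⟨x, hx, rfl⟩ := mem_image.1 hz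
    exact hy.2 x hx
  have heq : X.image (y - ·) = B :=
    eq_of_subset_of_card_le hsub (by rw [card_image_of_injective _ sub_right_injective, h])
  rw [← heq, image_image]
  have : ((y - ·) ∘ (y - ·) : G → G) = id := by ext z; simp
  rw [this, image_id]

/-- In `ℤ/pℤ`: if `X = y − B` with `∅ ≠ B ≠ ℤ/pℤ`, the intersection `⋂_{x ∈ X} (x + B)` is exactly `{y}`.
[cite: NazarewiczEtAl2007, Thm 3 (proof, p. 11)] -/
theorem filter_forall_sub_mem_eq_singleton {B : Finset (ZMod p)} (hB : B.Nonempty) (hBp : #B < p)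
    (y : ZMod p) :
    (univ.filter fun z => ∀ x ∈ B.image (y - ·), z - x ∈ B) = {y} := by
  ext z
  simp only [mem_filter, mem_univ, true_and, mem_singleton, mem_image, forall_exists_index, and_imp,
    forall_apply_eq_imp_iff₂]
  constructor
  · intro h
    by_contra hzy
    have hd : z - y ≠ 0 := sub_ne_zero.2 hzy
    have hall : ∀ b ∈ B, b + (z - y) ∈ B := by
      intro b hb
      have := h b hb
      convert this using 1; abel
    have := Pollard.eq_univ_of_add_mem hB hd hall
    rw [this, card_univ, ZMod.card] at hBp
    exact lt_irrefl _ hBp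
  · rintro rfl b hb
    simpa using hb

/-! ### §6 Sufficiency of (i)–(iv) -/

/-- (i) `min(|A|,|B|) = t`: if `|B| = t` then `S_t(A,B) = |A||B| = t(|A| + |B| − t)`.
[cite: NazarewiczEtAl2007, §2 (p. 2, "when t = min{|A|,|B|} … S(A,B,t) = |A||B|")] -/
theorem critical_of_card_eq {A B : Finset (ZMod p)} {t : ℕ} (hB : #B = t) :
    ∑ x, min t (rep A B x) = t * (#A + #B - t) := by
  have h := NS_eq_card_mul_card (t := t) A (B := B) hB.le
  rw [NS_eq_sum_of_subset t (subset_univ (A + B))] at h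
  rw [h, hB, Nat.add_sub_cancel, mul_comm]

/-- (i), symmetric: `|A| = t`. [cite: NazarewiczEtAl2007, §2 (p. 2)] -/
theorem critical_of_card_eq_left {A B : Finset (ZMod p)} {t : ℕ} (hA : #A = t) :
    ∑ x, min t (rep A B x) = t * (#A + #B - t) := by
  have h := critical_of_card_eq (A := B) (B := A) hA
  rw [add_comm #B] at h
  rw [← h]
  exact Fintype.sum_congr _ _ fun x => by rw [rep_comm]

/-- Pigeonhole: `r_{A,B}(x) + p ≥ |A| + |B|` in `ℤ/pℤ`. [cite: NazarewiczEtAl2007, §2 (p. 3)] -/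
theorem card_add_card_le_rep_add (A B : Finset (ZMod p)) (x : ZMod p) :
    #A + #B ≤ rep A B x + p := by
  rw [rep_eq_card_filter_right]
  -- `B.filter (x - b ∈ A)` is the preimage of `A` under the injection `b ↦ x - b`
  have h1 : #(B.filter fun b => x - b ∈ A) = #((B.image (x - ·)) ∩ A) := by
    rw [← card_image_of_injective (B.filter fun b => x - b ∈ A)
      (sub_right_injective : Function.Injective fun b : ZMod p => x - b)]
    congr 1
    ext z
    simp only [mem_image, mem_filter, mem_inter]
    constructor
    · rintro ⟨b, ⟨hb, hbA⟩, rfl⟩; exact ⟨⟨b, hb, rfl⟩, hbA⟩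
    · rintro ⟨⟨b, hb, rfl⟩, hzA⟩; exact ⟨b, ⟨hb, hzA⟩, rfl⟩
  rw [h1]
  have h2 := card_union_add_card_inter (B.image (x - ·)) A
  rw [card_image_of_injective _ sub_right_injective] at h2
  have h3 : #(B.image (x - ·) ∪ A) ≤ p := (card_le_univ _).trans (ZMod.card p).le
  omega

/-- (ii) `|A| + |B| ≥ p + t`: then every `x` has `r(x) ≥ t` and `S_t(A,B) = tp`.
[cite: NazarewiczEtAl2007, §2 (p. 3)] -/
theorem critical_of_le_card_add {A B : Finset (ZMod p)} {t : ℕ} (h : p + t ≤ #A + #B) :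
    ∑ x, min t (rep A B x) = t * p := by
  have : ∀ x, min t (rep A B x) = t := fun x =>
    min_eq_left (by have := card_add_card_le_rep_add A B x; omega)
  rw [Fintype.sum_congr _ _ this, sum_const, card_univ, ZMod.card, smul_eq_mul, mul_comm]

/-- (iii) / **Lemma 2**: if `|A| = t + 1`, `B = g − A` and `|A| + |B| ≤ p + t − 1`, then `(A, B)` is
`t`-critical (`g` has `t + 1` representations and is the only such element; all other sums count in
full). [cite: NazarewiczEtAl2007, Lemma 2] -/
theorem critical_of_eq_image_sub {A : Finset (ZMod p)} {t : ℕ} (g : ZMod p) (hA : #A = t + 1)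
    (hAp : #A + #A ≤ p + t - 1) :
    ∑ x, min t (rep A (A.image (g - ·)) x) = t * (#A + #(A.image (g - ·)) - t) := by
  have hp2 := hp.out.two_le
  obtain ⟨B, hB⟩ : ∃ B : Finset (ZMod p), B = A.image (g - ·) := ⟨_, rfl⟩
  rw [← hB]
  have hBcard : #B = t + 1 := by rw [hB, card_image_of_injective _ sub_right_injective, hA]
  have hAne : A.Nonempty := card_pos.1 (by omega)
  have hAlt : #A < p := by omega
  have hr : ∀ x, rep A B x ≤ t + 1 := fun x => hBcard ▸ rep_le_card_right A B x
  have hpt : ∀ x, min t (rep A B x) + (if rep A B x = t + 1 then 1 else 0) = rep A B x := by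
    intro x; have := hr x; split_ifs <;> omega
  have hsum := Fintype.sum_congr _ _ hpt
  rw [sum_add_distrib, sum_rep, sum_boole, Nat.cast_id] at hsum
  -- the only `x` with `t + 1` representations is `g`
  have hset : univ.filter (fun x => rep A B x = t + 1) = {g} := by
    ext w
    rw [mem_filter, mem_singleton, ← hBcard, rep_eq_card_right_iff]
    simp only [mem_univ, true_and]
    constructor
    · intro h
      by_contra hwg
      have hd : w - g ≠ 0 := sub_ne_zero.2 hwg
      have hall : ∀ a ∈ A, a + (w - g) ∈ A := by
        intro a ha
        have := h (g - a) (by rw [hB]; exact mem_image.2 ⟨a, ha, rfl⟩)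
        convert this using 1; abel
      have := Pollard.eq_univ_of_add_mem hAne hd hall
      rw [this, card_univ, ZMod.card] at hAlt
      exact lt_irrefl _ hAlt
    · intro hwg b hb
      subst hwg
      rw [hB, mem_image] at hb
      obtain ⟨a', ha', rfl⟩ := hb
      simpa using ha'
  rw [hset, card_singleton, hA, hBcard] at hsum
  rw [hBcard, hA]
  have e : t + 1 + (t + 1) - t = t + 2 := by omega
  rw [e]
  nlinarith [hsum]

/-- (iv) **Arithmetic progressions with a common difference are `t`-critical** ("the sufficiency of
condition (iv) is an easy exercise"): for `d ≠ 0`, `A = {a, a + d, …, a + (k−1)d}`,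
`B = {b, …, b + (ℓ−1)d}`, `1 ≤ t ≤ min(k, ℓ)` and `k + ℓ ≤ p + t − 1`, `S_t(A,B) = t(k + ℓ − t)`.
Proof through the criterion (§4) for the translates `{0,…,(k−1)d}` and `{(k−t)d, …, (k−t+ℓ−1)d}`,
which meet in exactly `t` points. [cite: NazarewiczEtAl2007, Thm 3 (sufficiency of (iv))] -/
theorem critical_of_apFinset {d : ZMod p} (hd : d ≠ 0) (a b : ZMod p) {k l t : ℕ} (ht : 1 ≤ t)
    (htk : t ≤ k) (htl : t ≤ l) (hkl : k + l ≤ p + t - 1) :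
    ∑ x, min t (rep (apFinset a d k) (apFinset b d l) x) = t * (k + l - t) := by
  have hp := hp.out
  have hkp : k ≤ p := by omega
  have hlp : l ≤ p := by omega
  -- translate to `A₀ = apFinset 0 d k`, `B₀ = apFinset ((k - t) • d) d l`
  have htrans : ∑ x, min t (rep (apFinset a d k) (apFinset b d l) x) =
      ∑ x, min t (rep (apFinset 0 d k) (apFinset (((k - t : ℕ) : ZMod p) * d) d l) x) := by
    have h := sum_min_rep_image_add (apFinset 0 d k) (apFinset (((k - t : ℕ) : ZMod p) * d) d l)
      a (b - ((k - t : ℕ) : ZMod p) * d) t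
    rw [← h]
    congr 1; ext x; congr 2
    · rw [← vadd_finset_eq_image, vadd_apFinset, add_zero]
    · rw [← vadd_finset_eq_image, vadd_apFinset, sub_add_cancel]
  rw [htrans]
  set A := apFinset (0 : ZMod p) d k with hA
  set B := apFinset (((k - t : ℕ) : ZMod p) * d) d l with hB
  -- index description: `i • d` with `i < p` are distinct
  have hinj : ∀ i j : ℕ, i < p → j < p → (i : ZMod p) * d = (j : ZMod p) * d → i = j := by
    intro i j hi hj hij
    have h1 : (i : ZMod p) = (j : ZMod p) := mul_right_cancel₀ hd hij
    have h2 := congrArg ZMod.val h1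
    rwa [ZMod.val_natCast, ZMod.val_natCast, Nat.mod_eq_of_lt hi, Nat.mod_eq_of_lt hj] at h2
  have hmemA : ∀ x, x ∈ A ↔ ∃ i, i < k ∧ x = (i : ZMod p) * d := by
    intro x
    rw [hA, mem_apFinset]
    constructor
    · rintro ⟨i, hi, rfl⟩; exact ⟨i, hi, by simp [nsmul_eq_mul]⟩
    · rintro ⟨i, hi, rfl⟩; exact ⟨i, hi, by simp [nsmul_eq_mul]⟩
  have hmemB : ∀ x, x ∈ B ↔ ∃ j, j < l ∧ x = ((k - t + j : ℕ) : ZMod p) * d := by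
    intro x
    rw [hB, mem_apFinset]
    constructor
    · rintro ⟨j, hj, rfl⟩; exact ⟨j, hj, by push_cast; simp [nsmul_eq_mul]; ring⟩
    · rintro ⟨j, hj, rfl⟩; exact ⟨j, hj, by push_cast; simp [nsmul_eq_mul]; ring⟩
  -- `A ∩ B` consists of the `i • d` with `k - t ≤ i < k`
  have hinter : ∀ x, x ∈ A ∩ B ↔ ∃ i, k - t ≤ i ∧ i < k ∧ x = (i : ZMod p) * d := by
    intro x
    rw [mem_inter, hmemA, hmemB]
    constructor
    · rintro ⟨⟨i, hi, rfl⟩, ⟨j, hj, hij⟩⟩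
      have := hinj i (k - t + j) (by omega) (by omega) hij
      exact ⟨i, by omega, hi, rfl⟩
    · rintro ⟨i, hi1, hi2, rfl⟩
      exact ⟨⟨i, hi2, rfl⟩, ⟨i - (k - t), by omega, by congr 2; omega⟩⟩
  have hIcard : #(A ∩ B) = t := by
    have : A ∩ B = (Finset.Ico (k - t) k).image fun i : ℕ => (i : ZMod p) * d := by
      ext x; rw [hinter, mem_image]; simp only [Finset.mem_Ico]
      constructor
      · rintro ⟨i, h1, h2, rfl⟩; exact ⟨i, ⟨h1, h2⟩, rfl⟩
      · rintro ⟨i, ⟨h1, h2⟩, rfl⟩; exact ⟨i, h1, h2, rfl⟩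
    rw [this, card_image_of_injOn, Nat.card_Ico]; · omega
    intro i hi j hj hij
    simp only [coe_Ico, Set.mem_Ico] at hi hj
    exact hinj i j (by omega) (by omega) hij
  have hUcard : #(A ∪ B) = k + l - t := by
    have h1 := card_union_add_card_inter A B
    rw [hIcard, hA, hB, card_apFinset hd hkp, card_apFinset hd hlp] at h1
    rw [hA, hB] ; omega
  rw [← hUcard, critical_iff_of_card_inter hIcard]
  intro a' ha' b' hb' i hi
  rw [mem_sdiff, hmemA] at ha'
  rw [mem_sdiff, hmemB] at hb'
  obtain ⟨⟨α, hα, rfl⟩, hαB⟩ := ha'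
  obtain ⟨⟨β, hβ, rfl⟩, hβA⟩ := hb'
  obtain ⟨γ, hγ1, hγ2, rfl⟩ := (hinter i).1 hi
  -- `α < k - t` (else `α • d ∈ B`), `β ≥ t` (else `(k - t + β) • d ∈ A`)
  have hα' : α < k - t := by
    by_contra h; push Not at h
    exact hαB ((hmemB _).2 ⟨α - (k - t), by omega, by congr 2; omega⟩)
  have hβ' : t ≤ β := by
    by_contra h; push Not at h
    exact hβA ((hmemA _).2 ⟨k - t + β, by omega, rfl⟩)
  -- the sum is `m • d` with `m = α + (k - t + β) - γ`, `1 ≤ m ≤ k + l - t - 2`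
  have hm : (α : ZMod p) * d + ((k - t + β : ℕ) : ZMod p) * d - (γ : ZMod p) * d =
      ((α + (k - t + β) - γ : ℕ) : ZMod p) * d := by
    have : γ ≤ α + (k - t + β) := by omega
    push_cast [this]
    ring
  rw [hm, mem_union]
  by_cases hlt : α + (k - t + β) - γ < k
  · exact Or.inl ((hmemA _).2 ⟨_, hlt, rfl⟩)
  · refine Or.inr ((hmemB _).2 ⟨α + (k - t + β) - γ - (k - t), by omega, ?_⟩)
    congr 2; omega

/-! ### §7 The endpoint cases -/

/-- **`min(|A|,|B|) = t + 1`** (printed Lemmas 3, 4 and Corollary 1): if `(A,B)` is `t`-critical with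
`t ≥ 1`, `|B| = t + 1 ≤ |A|` and `|A| + |B| ≤ p + t − 1`, then either `|A| = t + 1` and `B = g − A`, or
`A` and `B` are arithmetic progressions with a common nonzero difference.  Here obtained from the
`1`-critical complement pair `(Aᶜ, B)` (§1) and Vosper's theorem.
[cite: NazarewiczEtAl2007, Lemma 3, Lemma 4 and Corollary 1] -/
theorem endpoint_card_succ {A B : Finset (ZMod p)} {t : ℕ} (ht : 1 ≤ t) (hB : #B = t + 1)
    (hBA : t + 1 ≤ #A) (hAB : #A + #B ≤ p + t - 1)
    (hcrit : ∑ x, min t (rep A B x) = t * (#A + #B - t)) :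
    (#A = t + 1 ∧ ∃ g, B = A.image (g - ·)) ∨ ∃ d, d ≠ 0 ∧ IsAP A d ∧ IsAP B d := by
  have hp2 := hp.out.two_le
  have hAp : #A ≤ p := (card_le_univ A).trans (ZMod.card p).le
  have hdual := critical_compl_left (by omega : t ≤ #A) (by omega : t ≤ #B) hcrit
  have hcA : #Aᶜ = p - #A := by rw [card_compl, ZMod.card]
  rw [hB, show t + 1 - t = 1 by omega, sum_min_one_rep, one_mul, hcA] at hdual
  have hAcne : Aᶜ.Nonempty := card_pos.1 (by rw [hcA]; omega)
  have hBne : B.Nonempty := card_pos.1 (by omega)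
  have hne : Aᶜ + B ≠ univ := by
    intro h
    have := congrArg card h
    rw [hdual, card_univ, ZMod.card] at this
    omega
  have hv := (vosper hAcne hBne hne).1 (by rw [hdual, hcA]; omega)
  rcases hv with hmin | ⟨hp1, c, -, hBc⟩ | ⟨d, hAd, hBd⟩
  · exfalso
    rcases Nat.le_total #Aᶜ #B with h | h
    · rw [min_eq_left h] at hmin; omega
    · rw [min_eq_right h] at hmin; omega
  · left
    refine ⟨by rw [hdual] at hp1; omega, c, ?_⟩
    rw [hBc, compl_image_sub_compl]
  · right
    have hd : d ≠ 0 := hBd.ne_zero (by omega)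
    refine ⟨d, hd, ?_, hBd⟩
    have := hAd.compl hd
    rwa [compl_compl] at this

/-- The symmetric endpoint `|A| = t + 1 ≤ |B|`. [cite: NazarewiczEtAl2007, Corollary 1] -/
theorem endpoint_card_succ_left {A B : Finset (ZMod p)} {t : ℕ} (ht : 1 ≤ t) (hA : #A = t + 1)
    (hAB' : t + 1 ≤ #B) (hAB : #A + #B ≤ p + t - 1)
    (hcrit : ∑ x, min t (rep A B x) = t * (#A + #B - t)) :
    (#B = t + 1 ∧ ∃ g, B = A.image (g - ·)) ∨ ∃ d, d ≠ 0 ∧ IsAP A d ∧ IsAP B d := by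
  have hcrit' : ∑ x, min t (rep B A x) = t * (#B + #A - t) := by
    rw [add_comm #B, ← hcrit]; exact Fintype.sum_congr _ _ fun x => by rw [rep_comm]
  rcases endpoint_card_succ ht hA hAB' (by omega) hcrit' with ⟨hBt, g, hAg⟩ | ⟨d, hd, hBd, hAd⟩
  · left
    refine ⟨hBt, g, ?_⟩
    rw [hAg, image_image]
    have : ((g - ·) ∘ (g - ·) : ZMod p → ZMod p) = id := by ext z; simp
    rw [this, image_id]
  · exact Or.inr ⟨d, hd, hAd, hBd⟩

/-- **`|A| + |B| = p + t − 1`** (printed Lemma 5): if `(A,B)` is `t`-critical with `2 ≤ t`,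
`t + 1 ≤ |A|`, `t + 1 ≤ |B|` and `|A| + |B| = p + t − 1`, then `A` and `B` are arithmetic progressions
with a common nonzero difference — from the `1`-critical pair `(Aᶜ, Bᶜ)` (§1) and Vosper's theorem
("Vosper's theorem now shows that `Ā` and `B̄` are arithmetic progressions with the same common
difference and therefore so are `A` and `B`"). [cite: NazarewiczEtAl2007, Lemma 5] -/
theorem endpoint_card_add {A B : Finset (ZMod p)} {t : ℕ} (ht : 2 ≤ t) (htA : t + 1 ≤ #A)
    (htB : t + 1 ≤ #B) (hAB : #A + #B = p + t - 1)
    (hcrit : ∑ x, min t (rep A B x) = t * (#A + #B - t)) :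
    ∃ d, d ≠ 0 ∧ IsAP A d ∧ IsAP B d := by
  have hp2 := hp.out.two_le
  have hAp : #A ≤ p := (card_le_univ A).trans (ZMod.card p).le
  have hBp : #B ≤ p := (card_le_univ B).trans (ZMod.card p).le
  have h := critical_compl_compl (by omega : t ≤ #A) (by omega : t ≤ #B) (by omega) hcrit
  have hlev : p + t - #A - #B = 1 := by omega
  rw [hlev, sum_min_one_rep, one_mul] at h
  have hcA : #Aᶜ = p - #A := by rw [card_compl, ZMod.card]
  have hcB : #Bᶜ = p - #B := by rw [card_compl, ZMod.card]
  obtain ⟨d, hd, hAd, hBd⟩ := vosper_inverse (A := Aᶜ) (B := Bᶜ) (by rw [hcA]; omega)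
    (by rw [hcB]; omega) (by rw [h, hcA, hcB]; omega) (by rw [h]; omega)
  refine ⟨d, hd, ?_, ?_⟩
  · have := hAd.compl hd; rwa [compl_compl] at this
  · have := hBd.compl hd; rwa [compl_compl] at this

end ZModP2

end PollardEquality

end Literature.Combinatorics.Additive
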